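import Literature.Computability.Learning.LearnerParamsFP
import Literature.Computability.Learning.AmpEvalFP
import HarnessLib

/-!
# The learner's table construction in `FP`

Machine-layer instalment (M8c) of the decomposition of the named fact
`Literature.Computability.Learning.cikk_natural_implies_learning` (CIKK 2016, Thm. 5.1): the
pattern inputs `patInput` of the NW tables (`NaturalLearningTables.lean`) as a string function,
on the table context `TC = ⟨hdr, ⟨ibits, ⟨zbits, ⟨1ⁿ, 1ᵏ⟩⟩⟩⟩` (`hdr = predHdr ε q ℓ n' L`):
`patInputFn ⟨⟨TC, 1ʲ⟩, 1ᶜ⟩ = List.ofFn (patInput q ℓ (learnerDesign …) i j z c)`. The learner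
queries `f` at the `k` blocks of these inputs and combines the answers with the mask bits into
the table entries `AMP(f)(patInput …)`.

## References

* M. Carmosino, R. Impagliazzo, V. Kabanets, A. Kolokolova, *Learning algorithms from natural
  proofs*, CCC 2016, §2.4 (preprocessing, step 4) and §5 [CarmosinoImpagliazzoKabanetsKolokolova2016].
-/

open Polynomial

namespace Literature.Computability.Learning

open Literature.Computability.Complexity Literature.Computability.Complexity.Brick
  Literature.Computability.Complexity.Plumb Literature.Computability.MetaComplexity
  Literature.Computability.Cryptography _root_.Computability Finset

/-! ### The matching mask as a function -/

/-- **The matching mask of blocks `i` and `j` is the indicator of `colMatch`.** [folklore] -/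
theorem matchMaskFn_eq_ofFn {q ℓ n' L : ℕ} (pad : List Bool) (i : Fin (2 ^ ℓ)) {j : ℕ} (hj : j < 2 ^ ℓ) :
    matchMaskFn (boolPair (predHdr pad q ℓ n' L)
      (boolPair (List.ofFn ((boolFunEquivFin ℓ).symm i)) (List.ofFn fun r : Fin ℓ => j.testBit r))) =
      List.ofFn fun τ : Fin n' => decide (colMatch q ℓ i ⟨j, hj⟩ τ) := by
  rw [matchMaskFn_apply, ofFn_testBit_eq hj]
  exact ccat_singleton_eq_ofFn (fun τ => decide (colMatch q ℓ i ⟨j, hj⟩ τ)) n'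

/-- The rank of a column is the number of matching columns before it, read off the mask. [folklore] -/
theorem count_take_mask {q ℓ n' : ℕ} (i j : Fin (2 ^ ℓ)) {τ : ℕ} (hτ : τ ≤ n') :
    ((List.ofFn fun τ : Fin n' => decide (colMatch q ℓ i j τ)).take τ).count true = rank q ℓ i j τ := by
  rw [rank]
  induction τ with
  | zero => simp
  | succ τ ih =>
    rw [List.take_add_one, List.count_append, ih (by omega), Finset.range_add_one, Finset.filter_insert,
      List.getElem?_eq_getElem (by simpa using hτ), List.getElem_ofFn]
    simp only [Option.toList_some, List.count_singleton']
    by_cases h : colMatch q ℓ i j τ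
    · rw [if_pos h, Finset.card_insert_of_notMem (by simp), decide_eq_true h]; simp
    · rw [if_neg h, decide_eq_false h]; simp

/-! ### The pattern input -/

/-- The table context `⟨hdr, ⟨ibits, ⟨zbits, ⟨1ⁿ, 1ᵏ⟩⟩⟩⟩`. [folklore] -/
def tblCtx (q n k ℓ : ℕ) (ibits zbits : List Bool) : List Bool :=
  boolPair (predHdr [] q ℓ (k * n + k) (2 ^ ℓ)) (boolPair ibits (boolPair zbits (boolPair (ones n) (ones k))))

/-- The pattern context `⟨mask, ⟨z|_{S_j}, bin c⟩⟩` from `⟨⟨TC, 1ʲ⟩, 1ᶜ⟩`, `TC = ⟨hdr, ⟨ibits, ⟨zbits, ⟨1ⁿ, 1ᵏ⟩⟩⟩⟩`. [folklore] -/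
noncomputable def patCtxFn : List Bool → List Bool :=
  (fanoutFn (matchMaskFn ∘ (fanoutFn (fstF ∘ (fstF ∘ fstF)) (fanoutFn (nthF 1 ∘ (fstF ∘ fstF)) (bitsOfFn ∘ (fanoutFn (nthF 2 ∘ (fstF ∘ (fstF ∘ fstF))) (sndF ∘ fstF)))))) (fanoutFn (restrictFn ∘ (fanoutFn (fanoutFn (fun _ => []) (fanoutFn (nthF 1 ∘ (fstF ∘ (fstF ∘ fstF))) (fanoutFn (nthF 2 ∘ (fstF ∘ (fstF ∘ fstF))) (fanoutFn (bitsOfFn ∘ (fanoutFn (nthF 2 ∘ (fstF ∘ (fstF ∘ fstF))) (sndF ∘ fstF))) (nthF 2 ∘ (fstF ∘ fstF)))))) (nthF 3 ∘ (fstF ∘ (fstF ∘ fstF))))) (lenBinF ∘ sndF)))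

/-- `patCtxFn ∈ FP`. [folklore] -/
theorem patCtxFn_mem_FP : patCtxFn ∈ FP :=
  (fanoutFn_mem_FP (comp_mem_FP matchMaskFn_mem_FP (fanoutFn_mem_FP (comp_mem_FP fstF_mem_FP (comp_mem_FP fstF_mem_FP fstF_mem_FP)) (fanoutFn_mem_FP (comp_mem_FP (nthF_mem_FP 1) (comp_mem_FP fstF_mem_FP fstF_mem_FP)) (comp_mem_FP bitsOfFn_mem_FP (fanoutFn_mem_FP (comp_mem_FP (nthF_mem_FP 2) (comp_mem_FP fstF_mem_FP (comp_mem_FP fstF_mem_FP fstF_mem_FP))) (comp_mem_FP sndF_mem_FP fstF_mem_FP)))))) (fanoutFn_mem_FP (comp_mem_FP restrictFn_mem_FP (fanoutFn_mem_FP (fanoutFn_mem_FP (const_mem_FP _) (fanoutFn_mem_FP (comp_mem_FP (nthF_mem_FP 1) (comp_mem_FP fstF_mem_FP (comp_mem_FP fstF_mem_FP fstF_mem_FP))) (fanoutFn_mem_FP (comp_mem_FP (nthF_mem_FP 2) (comp_mem_FP fstF_mem_FP (comp_mem_FP fstF_mem_FP fstF_mem_FP))) (fanoutFn_mem_FP (comp_mem_FP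 bitsOfFn_mem_FP (fanoutFn_mem_FP (comp_mem_FP (nthF_mem_FP 2) (comp_mem_FP fstF_mem_FP (comp_mem_FP fstF_mem_FP fstF_mem_FP))) (comp_mem_FP sndF_mem_FP fstF_mem_FP))) (comp_mem_FP (nthF_mem_FP 2) (comp_mem_FP fstF_mem_FP fstF_mem_FP)))))) (comp_mem_FP (nthF_mem_FP 3) (comp_mem_FP fstF_mem_FP (comp_mem_FP fstF_mem_FP fstF_mem_FP))))) (comp_mem_FP lenBinF_mem_FP sndF_mem_FP)))


/-- Value of `patCtxFn` on a genuine context (`j < 2^ℓ`). [folklore] -/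
theorem patCtxFn_apply {q n k ℓ : ℕ} [Fact q.Prime] (hn : k * n + k ≤ q) (i : Fin (2 ^ ℓ)) (z : Fin (q * q) → Bool)
    {j : ℕ} (hj : j < 2 ^ ℓ) (c : ℕ) :
    patCtxFn (boolPair (boolPair (tblCtx q n k ℓ (List.ofFn ((boolFunEquivFin ℓ).symm i)) (List.ofFn z)) (ones j)) (ones c)) =
      boolPair (List.ofFn fun τ : Fin (k * n + k) => decide (colMatch q ℓ i ⟨j, hj⟩ τ))
        (boolPair (List.ofFn (z ∘ learnerDesign q n k ℓ hn ⟨j, hj⟩)) (encodeNat c)) := by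
  have h1 : nthF 1 (predHdr [] q ℓ (k * n + k) (2 ^ ℓ)) = ones q := by simp [predHdr, nthF]
  have h2 : nthF 2 (predHdr [] q ℓ (k * n + k) (2 ^ ℓ)) = ones ℓ := by simp [predHdr, nthF]
  have h3 : nthF 3 (predHdr [] q ℓ (k * n + k) (2 ^ ℓ)) = ones (k * n + k) := by simp [predHdr, nthF]
  rw [patCtxFn, fanoutFn_apply, fanoutFn_apply]
  simp only [Function.comp_apply, fanoutFn_apply, fstF_boolPair, sndF_boolPair, tblCtx, nthF] at *
  rw [h2, bitsOfFn_apply, matchMaskFn_eq_ofFn [] i hj, h1, h3, lenBinF_apply, length_ones, ofFn_testBit_eq hj,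
    show boolPair [] (boolPair (ones q) (boolPair (ones ℓ) (boolPair (List.ofFn ((boolFunEquivFin ℓ).symm ⟨j, hj⟩)) (List.ofFn z)))) =
      designCtx [] q ℓ (List.ofFn ((boolFunEquivFin ℓ).symm ⟨j, hj⟩)) (List.ofFn z) from rfl,
    restrictFn_eq_ofFn_cikkDesign [] q (k * n + k) ℓ hn]
  rfl

/-- Reading position `m` with default. [folklore] -/
theorem headD_take_one_drop (l : List Bool) (m : ℕ) : ((l.drop m).take 1).headD false = l.getD m false := by
  rw [List.getD_eq_getElem?_getD, ← List.head?_drop]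
  cases l.drop m <;> rfl

/-- The piece of the pattern fold on `⟨⟨mask, ⟨z|_{S_j}, bin c⟩⟩, 1^τ⟩`: bit `rank τ` of `c` on a
matching column, `z(e_j τ)` elsewhere. [cite: CarmosinoImpagliazzoKabanetsKolokolova2016, §2.4 (preprocessing, step 4)] -/
noncomputable def patInPiece : List Bool → List Bool :=
  iteFn (HashBricks.headBitFn ∘ (bitAtFn ∘ (fanoutFn sndF (fstF ∘ fstF))))
    (HashBricks.headBitFn ∘ (bitAtFn ∘ (fanoutFn (binToUnaryFn ∘ (fanoutFn (fstF ∘ fstF) (HashBricks.popCountFn ∘ (takeFn ∘ (fanoutFn sndF (fstF ∘ fstF)))))) (sndPow 1 ∘ fstF))))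
    (HashBricks.headBitFn ∘ (bitAtFn ∘ (fanoutFn sndF (nthF 1 ∘ fstF))))

/-- `patInPiece ∈ FP`. [folklore] -/
theorem patInPiece_mem_FP : patInPiece ∈ FP :=
  iteFn_mem_FP (comp_mem_FP HashBricks.headBitFn_mem_FP (comp_mem_FP bitAtFn_mem_FP (fanoutFn_mem_FP sndF_mem_FP (comp_mem_FP fstF_mem_FP fstF_mem_FP))))
    (comp_mem_FP HashBricks.headBitFn_mem_FP (comp_mem_FP bitAtFn_mem_FP (fanoutFn_mem_FP (comp_mem_FP binToUnaryFn_mem_FP (fanoutFn_mem_FP (comp_mem_FP fstF_mem_FP fstF_mem_FP) (comp_mem_FP HashBricks.popCountFn_mem_FP (comp_mem_FP takeFn_mem_FP (fanoutFn_mem_FP sndF_mem_FP (comp_mem_FP fstF_mem_FP fstF_mem_FP)))))) (comp_mem_FP (sndPow_mem_FP 1) fstF_mem_FP))))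
    (comp_mem_FP HashBricks.headBitFn_mem_FP (comp_mem_FP bitAtFn_mem_FP (fanoutFn_mem_FP sndF_mem_FP (comp_mem_FP (nthF_mem_FP 1) fstF_mem_FP))))

/-- `patInPiece` is one-bit. [folklore] -/
theorem oneBit_patInPiece : OneBit patInPiece :=
  (HashBricks.oneBit_headBitFn.comp _).ite (HashBricks.oneBit_headBitFn.comp _) (HashBricks.oneBit_headBitFn.comp _)

/-- Value of `patInPiece` on genuine data (`τ < n'`). [folklore] -/
theorem patInPiece_apply {n' : ℕ} (dm : Fin n' → Bool) (zr : Fin n' → Bool) (c : ℕ) {τ : ℕ} (hτ : τ < n') :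
    patInPiece (boolPair (boolPair (List.ofFn dm) (boolPair (List.ofFn zr) (encodeNat c))) (ones τ)) =
      [if dm ⟨τ, hτ⟩ then c.testBit (((List.ofFn dm).take τ).count true) else zr ⟨τ, hτ⟩] := by
  have hb : ∀ u : Fin n' → Bool, HashBricks.headBitFn (bitAtFn (boolPair (ones τ) (List.ofFn u))) = [u ⟨τ, hτ⟩] := by
    intro u; rw [bitAtFn_boolPair, HashBricks.headBitFn_apply, length_ones, take_one_drop_ofFn u hτ]; rfl
  rw [patInPiece, iteFn_apply (b := dm ⟨τ, hτ⟩) (by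
    simp only [Function.comp_apply, fanoutFn_apply, sndF_boolPair, fstF_boolPair, hb])]
  cases dm ⟨τ, hτ⟩
  · simp only [Bool.false_eq_true, ite_false, Function.comp_apply, fanoutFn_apply, sndF_boolPair, fstF_boolPair, nthF, hb]
  · simp only [ite_true, Function.comp_apply, fanoutFn_apply, sndF_boolPair, fstF_boolPair, sndPow, nthF,
      takeFn_boolPair, length_ones, HashBricks.popCountFn_apply,
      binToUnaryFn_boolPair, bitsToNat_encodeNat, List.length_ofFn, bitAtFn_boolPair, HashBricks.headBitFn_apply]
    have hcnt : ((List.ofFn dm).take τ).count true ≤ n' := List.count_le_length.trans (by simp)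
    rw [headD_take_one_drop, testBit_eq_getD_encodeNat, min_eq_left hcnt]

/-- The pattern pieces are one bit. [folklore] -/
theorem length_patInPiece (w : List Bool) : (patInPiece w).length = 1 := oneBit_patInPiece.length_eq w

/-- **The pattern input** `patInput q ℓ e i j z c` as `n'` bits, on `⟨⟨TC, 1ʲ⟩, 1ᶜ⟩`.
[cite: CarmosinoImpagliazzoKabanetsKolokolova2016, §2.4 (preprocessing, step 4)] -/
noncomputable def patInputFn : List Bool → List Bool :=
  sndPow 2 ∘ foldLoop appF (clipF 1 patInPiece) X ∘
    fanoutFn id (fanoutFn (lenBinF ∘ fstF) (fun _ => boolPair [] [])) ∘ patCtxFn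

/-- `patInputFn ∈ FP`. [folklore] -/
theorem patInputFn_mem_FP : patInputFn ∈ FP :=
  comp_mem_FP (sndPow_mem_FP 2) (comp_mem_FP
    (foldLoop_clipF_mem_FP 1 appF_mem_FP length_appF_le patInPiece_mem_FP X)
    (comp_mem_FP (fanoutFn_mem_FP (PolyTimeComputable.id _)
      (fanoutFn_mem_FP (comp_mem_FP lenBinF_mem_FP fstF_mem_FP) (const_mem_FP _))) patCtxFn_mem_FP))

/-- **Value of `patInputFn`**: the bits of `patInput`. [cite: CarmosinoImpagliazzoKabanetsKolokolova2016, §2.4] -/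
theorem patInputFn_apply {q n k ℓ : ℕ} [Fact q.Prime] (hn : k * n + k ≤ q) (i : Fin (2 ^ ℓ)) (z : Fin (q * q) → Bool)
    {j : ℕ} (hj : j < 2 ^ ℓ) (c : ℕ) :
    patInputFn (boolPair (boolPair (tblCtx q n k ℓ (List.ofFn ((boolFunEquivFin ℓ).symm i)) (List.ofFn z)) (ones j)) (ones c)) =
      List.ofFn (patInput q ℓ (learnerDesign q n k ℓ hn) i ⟨j, hj⟩ z c) := by
  rw [patInputFn, Function.comp_apply, Function.comp_apply, Function.comp_apply, patCtxFn_apply hn i z hj c]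
  set dm : Fin (k * n + k) → Bool := fun τ => decide (colMatch q ℓ i ⟨j, hj⟩ τ) with hdm
  have hn' : k * n + k ≤ X.eval (boolPair (List.ofFn dm) (boolPair (List.ofFn (z ∘ learnerDesign q n k ℓ hn ⟨j, hj⟩))
      (encodeNat c))).length := by rw [eval_X, length_boolPair, List.length_ofFn]; omega
  rw [fanoutFn_apply, fanoutFn_apply, id, Function.comp_apply, fstF_boolPair,
    lenBinF_apply, List.length_ofFn, show (boolPair ([] : List Bool) []) = boolPair (ones 0) ([] : List Bool) by rfl,
    foldLoop_apply _ _ hn', foldAcc_clipF (fun τ _ _ => by rw [length_patInPiece]; omega), foldAcc_appF]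
  simp only [sndPow, Function.comp_apply, sndF_boolPair, zero_add, List.nil_append]
  rw [ccat_congr (g' := fun τ => [if h : τ < k * n + k then patInput q ℓ (learnerDesign q n k ℓ hn) i ⟨j, hj⟩ z c ⟨τ, h⟩ else false])
    (fun τ hτ => by
      rw [patInPiece_apply dm _ c hτ, dif_pos hτ, hdm, count_take_mask i ⟨j, hj⟩ hτ.le]
      simp only [patInput, Function.comp_apply]
      by_cases h : colMatch q ℓ i ⟨j, hj⟩ τ <;> simp [h]),
    ccat_singleton_eq_ofFn]
  exact congrArg List.ofFn (funext fun τ => by rw [dif_pos τ.isLt])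

/-- `|patInputFn …| = n'` on genuine contexts. [folklore] -/
theorem length_patInputFn_apply {q n k ℓ : ℕ} [Fact q.Prime] (hn : k * n + k ≤ q) (i : Fin (2 ^ ℓ)) (z : Fin (q * q) → Bool)
    {j : ℕ} (hj : j < 2 ^ ℓ) (c : ℕ) :
    (patInputFn (boolPair (boolPair (tblCtx q n k ℓ (List.ofFn ((boolFunEquivFin ℓ).symm i)) (List.ofFn z)) (ones j))
      (ones c))).length = k * n + k := by
  rw [patInputFn_apply hn i z hj c, List.length_ofFn]

/-! ### Table entries from the answers -/

/-- **A table entry from the membership answers**: on `⟨⟨⟨1ⁿ, 1ᵏ⟩, u⟩, fvals⟩` (`u` an `AMP` input,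
`fvals` the `k` answers `f(u-block c)`), the entry `AMP(f)(u) = ⊕_c (mask_c ∧ f(block_c))`.
[cite: CarmosinoImpagliazzoKabanetsKolokolova2016, §5 (step 2: the tables of `AMP(f)` by membership queries)] -/
noncomputable def entryFn : List Bool → List Bool :=
  HashBricks.andParityFn ∘ fanoutFn (maskFn ∘ fstF) sndF

/-- `entryFn ∈ FP`. [folklore] -/
theorem entryFn_mem_FP : entryFn ∈ FP :=
  comp_mem_FP HashBricks.andParityFn_mem_FP (fanoutFn_mem_FP (comp_mem_FP maskFn_mem_FP fstF_mem_FP) sndF_mem_FP)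

/-- **Value of `entryFn`**: with the true answers, the entry is `AMP(f)(u)`. [cite: CarmosinoImpagliazzoKabanetsKolokolova2016, §5] -/
theorem entryFn_apply {n k : ℕ} (f : (Fin n → Bool) → Bool) (uf : Fin (k * n + k) → Bool) :
    entryFn (boolPair (boolPair (boolPair (ones n) (ones k)) (List.ofFn uf))
      (List.ofFn fun c : Fin k => f fun d => uf (ampIdxEquiv n k (Sum.inl (c, d))))) = [ampFnFin f k uf] := by
  rw [entryFn, Function.comp_apply, fanoutFn_apply, Function.comp_apply, fstF_boolPair, sndF_boolPair, maskFn_apply,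
    drop_ofFn_eq_mask, andParityFn_eq_ampFnFin]

/-- The `c`-th block query of an `AMP` input: `f` is asked at `block_c(u)`. [folklore] -/
theorem blockFn_ofFn {n k : ℕ} (uf : Fin (k * n + k) → Bool) (c : Fin k) :
    blockFn (boolPair (boolPair (ones n) (ones c)) (List.ofFn uf)) =
      List.ofFn fun d : Fin n => uf (ampIdxEquiv n k (Sum.inl (c, d))) := by
  rw [blockFn_apply, drop_take_ofFn_eq_block]

/-! ### Tables from the answers -/

/-- The run context `RC = ⟨TC, answers⟩`. [folklore] -/
def runCtx (q n k ℓ : ℕ) (ibits zbits ans : List Bool) : List Bool := boolPair (tblCtx q n k ℓ ibits zbits) ans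

/-- The piece of the table fold at entry `c`, on `⟨⟨RC, 1ʲ⟩, 1ᶜ⟩` (`RC = ⟨TC, answers⟩`): the entry computed from the pattern input and the answer segment at offset `(jL + c)k`. [folklore] -/
noncomputable def entryPiece : List Bool → List Bool :=
  (entryFn ∘ (fanoutFn (fanoutFn (fanoutFn (nthF 3 ∘ (fstF ∘ (fstF ∘ fstF))) (sndPow 3 ∘ (fstF ∘ (fstF ∘ fstF)))) (patInputFn ∘ (fanoutFn (fanoutFn (fstF ∘ (fstF ∘ fstF)) (sndF ∘ fstF)) sndF))) (takeFn ∘ (fanoutFn (sndPow 3 ∘ (fstF ∘ (fstF ∘ fstF))) (dropFn ∘ (fanoutFn (HashBricks.umulFn ∘ (fanoutFn (appF ∘ (fanoutFn (HashBricks.umulFn ∘ (fanoutFn (sndF ∘ fstF) (sndPow 3 ∘ (fstF ∘ (fstF ∘ (fstF ∘ fstF)))))) sndF)) (sndPow 3 ∘ (fstF ∘ (fstF ∘ fstF))))) (sndF ∘ (fstF ∘ fstF))))))))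

/-- `entryPiece ∈ FP`. [folklore] -/
theorem entryPiece_mem_FP : entryPiece ∈ FP :=
  (comp_mem_FP entryFn_mem_FP (fanoutFn_mem_FP (fanoutFn_mem_FP (fanoutFn_mem_FP (comp_mem_FP (nthF_mem_FP 3) (comp_mem_FP fstF_mem_FP (comp_mem_FP fstF_mem_FP fstF_mem_FP))) (comp_mem_FP (sndPow_mem_FP 3) (comp_mem_FP fstF_mem_FP (comp_mem_FP fstF_mem_FP fstF_mem_FP)))) (comp_mem_FP patInputFn_mem_FP (fanoutFn_mem_FP (fanoutFn_mem_FP (comp_mem_FP fstF_mem_FP (comp_mem_FP fstF_mem_FP fstF_mem_FP)) (comp_mem_FP sndF_mem_FP fstF_mem_FP)) sndF_mem_FP))) (comp_mem_FP takeFn_mem_FP (fanoutFn_mem_FP (comp_mem_FP (sndPow_mem_FP 3) (comp_mem_FP fstF_mem_FP (comp_mem_FP fstF_mem_FP fstF_mem_FP))) (comp_mem_FP dropFn_mem_FP (fanoutFn_mem_FP (comp_mem_FP HashBricks.umulFn_mem_FP (fanoutFn_mem_FP (comp_mem_FP appF_mem_FP (fanoutFn_mem_FP (comp_mem_FP HashBricks.umulFn_mem_FP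 (fanoutFn_mem_FP (comp_mem_FP sndF_mem_FP fstF_mem_FP) (comp_mem_FP (sndPow_mem_FP 3) (comp_mem_FP fstF_mem_FP (comp_mem_FP fstF_mem_FP (comp_mem_FP fstF_mem_FP fstF_mem_FP)))))) sndF_mem_FP)) (comp_mem_FP (sndPow_mem_FP 3) (comp_mem_FP fstF_mem_FP (comp_mem_FP fstF_mem_FP fstF_mem_FP))))) (comp_mem_FP sndF_mem_FP (comp_mem_FP fstF_mem_FP fstF_mem_FP))))))))

/-- The number of entries `1^{E_j}`, `E_j = min(2^{#matching}, L)`, on `⟨RC, 1ʲ⟩`. [folklore] -/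
noncomputable def entriesFn : List Bool → List Bool :=
  (pow2CapFn ∘ (fanoutFn (sndPow 3 ∘ (fstF ∘ (fstF ∘ fstF))) (binToUnaryFn ∘ (fanoutFn (matchMaskFn ∘ (fanoutFn (fstF ∘ (fstF ∘ fstF)) (fanoutFn (nthF 1 ∘ (fstF ∘ fstF)) (bitsOfFn ∘ (fanoutFn (nthF 2 ∘ (fstF ∘ (fstF ∘ fstF))) sndF))))) (HashBricks.popCountFn ∘ (matchMaskFn ∘ (fanoutFn (fstF ∘ (fstF ∘ fstF)) (fanoutFn (nthF 1 ∘ (fstF ∘ fstF)) (bitsOfFn ∘ (fanoutFn (nthF 2 ∘ (fstF ∘ (fstF ∘ fstF))) sndF))))))))))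

/-- `entriesFn ∈ FP`. [folklore] -/
theorem entriesFn_mem_FP : entriesFn ∈ FP :=
  (comp_mem_FP pow2CapFn_mem_FP (fanoutFn_mem_FP (comp_mem_FP (sndPow_mem_FP 3) (comp_mem_FP fstF_mem_FP (comp_mem_FP fstF_mem_FP fstF_mem_FP))) (comp_mem_FP binToUnaryFn_mem_FP (fanoutFn_mem_FP (comp_mem_FP matchMaskFn_mem_FP (fanoutFn_mem_FP (comp_mem_FP fstF_mem_FP (comp_mem_FP fstF_mem_FP fstF_mem_FP)) (fanoutFn_mem_FP (comp_mem_FP (nthF_mem_FP 1) (comp_mem_FP fstF_mem_FP fstF_mem_FP)) (comp_mem_FP bitsOfFn_mem_FP (fanoutFn_mem_FP (comp_mem_FP (nthF_mem_FP 2) (comp_mem_FP fstF_mem_FP (comp_mem_FP fstF_mem_FP fstF_mem_FP))) sndF_mem_FP))))) (comp_mem_FP HashBricks.popCountFn_mem_FP (comp_mem_FP matchMaskFn_mem_FP (fanoutFn_mem_FP (comp_mem_FP fstF_mem_FP (comp_mem_FP fstF_mem_FP fstF_mem_FP)) (fanoutFn_mem_FP (comp_mem_FP (nthF_mem_FP 1)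 (comp_mem_FP fstF_mem_FP fstF_mem_FP)) (comp_mem_FP bitsOfFn_mem_FP (fanoutFn_mem_FP (comp_mem_FP (nthF_mem_FP 2) (comp_mem_FP fstF_mem_FP (comp_mem_FP fstF_mem_FP fstF_mem_FP))) sndF_mem_FP))))))))))

/-- **Table `j` from the answers**, on `⟨RC, 1ʲ⟩`: the `E_j` entries. [cite: CarmosinoImpagliazzoKabanetsKolokolova2016, §5 (step 2)] -/
noncomputable def tableFn : List Bool → List Bool :=
  (sndPow 2 ∘ (foldLoop appF (clipF 1 entryPiece) X ∘ (fanoutFn id (fanoutFn (lenBinF ∘ entriesFn) (fun _ => boolPair [] [])))))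

/-- `tableFn ∈ FP`. [folklore] -/
theorem tableFn_mem_FP : tableFn ∈ FP :=
  (comp_mem_FP (sndPow_mem_FP 2) (comp_mem_FP (foldLoop_clipF_mem_FP 1 appF_mem_FP length_appF_le entryPiece_mem_FP X) (fanoutFn_mem_FP (PolyTimeComputable.id _) (fanoutFn_mem_FP (comp_mem_FP lenBinF_mem_FP entriesFn_mem_FP) (const_mem_FP _)))))

/-- The piece of the tables fold: the item `⟨T_j⟩`. [folklore] -/
noncomputable def tablesPiece : List Bool → List Bool :=
  (fanoutFn tableFn (fun _ => []))

/-- `tablesPiece ∈ FP`. [folklore] -/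
theorem tablesPiece_mem_FP : tablesPiece ∈ FP :=
  (fanoutFn_mem_FP tableFn_mem_FP (const_mem_FP _))

/-- **The list code of the `L` tables** from the answers, on `RC = ⟨TC, answers⟩`. [cite: CarmosinoImpagliazzoKabanetsKolokolova2016, §5 (step 2)] -/
noncomputable def tablesFn : List Bool → List Bool :=
  (sndPow 2 ∘ (foldLoop appF (clipF 3 tablesPiece) X ∘ (fanoutFn id (fanoutFn (lenBinF ∘ (sndPow 3 ∘ (fstF ∘ fstF))) (fun _ => boolPair [] [])))))

/-- `tablesFn ∈ FP`. [folklore] -/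
theorem tablesFn_mem_FP : tablesFn ∈ FP :=
  (comp_mem_FP (sndPow_mem_FP 2) (comp_mem_FP (foldLoop_clipF_mem_FP 3 appF_mem_FP length_appF_le tablesPiece_mem_FP X) (fanoutFn_mem_FP (PolyTimeComputable.id _) (fanoutFn_mem_FP (comp_mem_FP lenBinF_mem_FP (comp_mem_FP (sndPow_mem_FP 3) (comp_mem_FP fstF_mem_FP fstF_mem_FP))) (const_mem_FP _)))))


section TableValues

variable {q n k ℓ : ℕ} [Fact q.Prime] (hn : k * n + k ≤ q) (f : (Fin n → Bool) → Bool) (i : Fin (2 ^ ℓ))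
  (z : Fin (q * q) → Bool)

/-- The answers of a run are correct: the segment at offset `(jL + c)k` lists `f` at the blocks of the
pattern input `patInput … j … c`. [folklore] -/
def AnswersOK (ans : List Bool) : Prop :=
  ∀ (j c : ℕ) (hj : j < 2 ^ ℓ), c < 2 ^ ℓ →
    (ans.drop ((j * 2 ^ ℓ + c) * k)).take k =
      List.ofFn fun blk : Fin k => f fun d => patInput q ℓ (learnerDesign q n k ℓ hn) i ⟨j, hj⟩ z c (ampIdxEquiv n k (Sum.inl (blk, d)))

variable {hn f i z} {ans : List Bool}

/-- Value of `entryPiece` with correct answers (`j, c < L`). [folklore] -/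
theorem entryPiece_apply (hans : AnswersOK hn f i z ans) {j c : ℕ} (hj : j < 2 ^ ℓ) (hc : c < 2 ^ ℓ) :
    entryPiece (boolPair (boolPair (runCtx q n k ℓ (List.ofFn ((boolFunEquivFin ℓ).symm i)) (List.ofFn z) ans) (ones j)) (ones c)) =
      [ampFnFin f k (patInput q ℓ (learnerDesign q n k ℓ hn) i ⟨j, hj⟩ z c)] := by
  have hL : sndPow 3 (fstF (tblCtx q n k ℓ (List.ofFn ((boolFunEquivFin ℓ).symm i)) (List.ofFn z))) = ones (2 ^ ℓ) := by
    simp [tblCtx, predHdr, sndPow]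
  have hnk : nthF 3 (tblCtx q n k ℓ (List.ofFn ((boolFunEquivFin ℓ).symm i)) (List.ofFn z)) = ones n ∧
      sndPow 3 (tblCtx q n k ℓ (List.ofFn ((boolFunEquivFin ℓ).symm i)) (List.ofFn z)) = ones k := by
    simp [tblCtx, nthF, sndPow]
  rw [entryPiece, Function.comp_apply, fanoutFn_apply, fanoutFn_apply, fanoutFn_apply]
  simp only [Function.comp_apply, fanoutFn_apply, fstF_boolPair, sndF_boolPair, runCtx, hL, hnk.1, hnk.2,
    HashBricks.umulFn_boolPair, appF_boolPair, ones_append_ones, takeFn_boolPair, dropFn_boolPair, length_ones,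
    patInputFn_apply hn i z hj c, hans j c hj hc]
  exact entryFn_apply f _

omit [Fact q.Prime] in
/-- Value of `entriesFn` (`j < L`). [folklore] -/
theorem entriesFn_apply {j : ℕ} (hj : j < 2 ^ ℓ) :
    entriesFn (boolPair (runCtx q n k ℓ (List.ofFn ((boolFunEquivFin ℓ).symm i)) (List.ofFn z) ans) (ones j)) =
      ones (min (2 ^ (matching q ℓ (k * n + k) i ⟨j, hj⟩).card) (2 ^ ℓ)) := by
  have hL : sndPow 3 (fstF (tblCtx q n k ℓ (List.ofFn ((boolFunEquivFin ℓ).symm i)) (List.ofFn z))) = ones (2 ^ ℓ) := by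
    simp [tblCtx, predHdr, sndPow]
  have hl : nthF 2 (fstF (tblCtx q n k ℓ (List.ofFn ((boolFunEquivFin ℓ).symm i)) (List.ofFn z))) = ones ℓ := by
    simp [tblCtx, predHdr, nthF]
  have hib : nthF 1 (tblCtx q n k ℓ (List.ofFn ((boolFunEquivFin ℓ).symm i)) (List.ofFn z)) =
      List.ofFn ((boolFunEquivFin ℓ).symm i) := by simp [tblCtx, nthF]
  have hhdr : fstF (tblCtx q n k ℓ (List.ofFn ((boolFunEquivFin ℓ).symm i)) (List.ofFn z)) = predHdr [] q ℓ (k * n + k) (2 ^ ℓ) := by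
    simp [tblCtx]
  rw [entriesFn, Function.comp_apply, fanoutFn_apply]
  simp only [Function.comp_apply, fanoutFn_apply, fstF_boolPair, sndF_boolPair, runCtx, hL, hl, hib, bitsOfFn_apply]
  rw [hhdr, matchMaskFn_eq_ofFn [] i hj, HashBricks.popCountFn_apply, binToUnaryFn_boolPair, bitsToNat_encodeNat,
    List.length_ofFn, min_eq_left (List.count_le_length.trans (by simp)), pow2CapFn_boolPair, length_ones, count_true_ofFn]
  congr 3
  exact congrArg Finset.card (Finset.filter_congr fun τ _ => by simp)

end TableValues

section TableValues2

variable {q n k ℓ : ℕ} [Fact q.Prime] {hn : k * n + k ≤ q} {f : (Fin n → Bool) → Bool} {i : Fin (2 ^ ℓ)}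
  {z : Fin (q * q) → Bool} {ans : List Bool}

/-- The number of entries of table `j`: `min (2^{#matching}) L` (`= 2^{#matching}` for `j ≠ i`). [folklore] -/
noncomputable def numEntries (q n k ℓ : ℕ) (i j : Fin (2 ^ ℓ)) : ℕ := min (2 ^ (matching q ℓ (k * n + k) i j).card) (2 ^ ℓ)

/-- The table of block `j` as the learner builds it. [folklore] -/
noncomputable def learnerTable (hn : k * n + k ≤ q) (f : (Fin n → Bool) → Bool) (i j : Fin (2 ^ ℓ)) (z : Fin (q * q) → Bool) :
    List Bool :=
  List.ofFn fun c : Fin (numEntries q n k ℓ i j) => ampFnFin f k (patInput q ℓ (learnerDesign q n k ℓ hn) i j z c)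

/-- **For `j < i` the learner's table is `tableList`** (of `AMP(f)`). [cite: CarmosinoImpagliazzoKabanetsKolokolova2016, §5 (step 2)] -/
theorem learnerTable_eq_tableList (hn : k * n + k ≤ q) (f : (Fin n → Bool) → Bool) {i j : Fin (2 ^ ℓ)} (hij : i ≠ j)
    (z : Fin (q * q) → Bool) :
    learnerTable hn f i j z = tableList (learnerDesign q n k ℓ hn) (ampFnFin f k) q i j z := by
  have hE : numEntries q n k ℓ i j = 2 ^ (matching q ℓ (k * n + k) i j).card :=
    min_eq_left (Nat.pow_le_pow_right (by norm_num) (card_matching_le hn hij))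
  rw [learnerTable, tableList]
  exact List.ofFn_congr hE _

/-- Value of `tableFn` with correct answers (`j < L`). [folklore] -/
theorem tableFn_apply (hans : AnswersOK hn f i z ans) {j : ℕ} (hj : j < 2 ^ ℓ) :
    tableFn (boolPair (runCtx q n k ℓ (List.ofFn ((boolFunEquivFin ℓ).symm i)) (List.ofFn z) ans) (ones j)) =
      learnerTable hn f i ⟨j, hj⟩ z := by
  have hE : numEntries q n k ℓ i ⟨j, hj⟩ ≤ X.eval (boolPair (runCtx q n k ℓ (List.ofFn ((boolFunEquivFin ℓ).symm i))
      (List.ofFn z) ans) (ones j)).length := by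
    rw [eval_X]
    refine (min_le_right _ _).trans ?_
    simp only [length_boolPair, runCtx, tblCtx, predHdr, length_ones]
    omega
  rw [tableFn, Function.comp_apply, Function.comp_apply, fanoutFn_apply, fanoutFn_apply, id, Function.comp_apply,
    entriesFn_apply hj, lenBinF_apply, length_ones, show (boolPair ([] : List Bool) []) = boolPair (ones 0) ([] : List Bool) by rfl,
    show min (2 ^ (matching q ℓ (k * n + k) i ⟨j, hj⟩).card) (2 ^ ℓ) = numEntries q n k ℓ i ⟨j, hj⟩ from rfl,
    foldLoop_apply _ _ hE, foldAcc_clipF (fun c _ hc => by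
      rw [zero_add] at hc
      rw [entryPiece_apply hans hj (lt_of_lt_of_le hc (min_le_right _ _))]; simp), foldAcc_appF]
  simp only [sndPow, Function.comp_apply, sndF_boolPair, zero_add, List.nil_append, learnerTable]
  rw [ccat_congr (g' := fun c => [if h : c < numEntries q n k ℓ i ⟨j, hj⟩ then
      ampFnFin f k (patInput q ℓ (learnerDesign q n k ℓ hn) i ⟨j, hj⟩ z c) else false])
    (fun c hc => by rw [dif_pos hc, entryPiece_apply hans hj (lt_of_lt_of_le hc (min_le_right _ _))]),
    ccat_singleton_eq_ofFn]
  exact congrArg List.ofFn (funext fun c => by rw [dif_pos c.isLt])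

/-- Concatenated singleton items form the list code. [folklore] -/
theorem flatten_ofFn_boolPair_nil : ∀ {L : ℕ} (T : Fin L → List Bool),
    (List.ofFn fun j : Fin L => boolPair (T j) []).flatten = OracleCompose.body (List.ofFn T)
  | 0, T => rfl
  | L + 1, T => by
    rw [List.ofFn_succ, List.flatten_cons, List.ofFn_succ, OracleCompose.body_cons, flatten_ofFn_boolPair_nil,
      ← boolPair_append_right, List.nil_append]

/-- **Value of `tablesFn`**: the list code of the learner's tables. [cite: CarmosinoImpagliazzoKabanetsKolokolova2016, §5 (step 2)] -/
theorem tablesFn_apply (hans : AnswersOK hn f i z ans) (hLk : 2 ^ ℓ ≤ ans.length) :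
    tablesFn (runCtx q n k ℓ (List.ofFn ((boolFunEquivFin ℓ).symm i)) (List.ofFn z) ans) =
      OracleCompose.body (List.ofFn fun j : Fin (2 ^ ℓ) => learnerTable hn f i j z) := by
  have hL : 2 ^ ℓ ≤ X.eval (runCtx q n k ℓ (List.ofFn ((boolFunEquivFin ℓ).symm i)) (List.ofFn z) ans).length := by
    rw [eval_X]; simp only [length_boolPair, runCtx, tblCtx, predHdr, length_ones]; omega
  have hLf : sndPow 3 (fstF (fstF (runCtx q n k ℓ (List.ofFn ((boolFunEquivFin ℓ).symm i)) (List.ofFn z) ans))) = ones (2 ^ ℓ) := by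
    simp [runCtx, tblCtx, predHdr, sndPow]
  rw [tablesFn, Function.comp_apply, Function.comp_apply, fanoutFn_apply, fanoutFn_apply, id, Function.comp_apply,
    Function.comp_apply, Function.comp_apply, hLf, lenBinF_apply, length_ones,
    show (boolPair ([] : List Bool) []) = boolPair (ones 0) ([] : List Bool) by rfl,
    foldLoop_apply _ _ hL, foldAcc_clipF (fun j _ hj => by
      rw [zero_add] at hj
      rw [tablesPiece, fanoutFn_apply, tableFn_apply hans hj, length_boolPair, learnerTable, List.length_ofFn, List.length_nil]
      have : numEntries q n k ℓ i ⟨j, hj⟩ ≤ ans.length := (min_le_right _ _).trans hLk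
      simp only [runCtx, length_boolPair]
      omega), foldAcc_appF]
  simp only [sndPow, Function.comp_apply, sndF_boolPair, zero_add, List.nil_append]
  rw [ccat_congr (g' := fun j => if h : j < 2 ^ ℓ then boolPair (learnerTable hn f i ⟨j, h⟩ z) [] else [])
    (fun j hj => by rw [dif_pos hj, tablesPiece, fanoutFn_apply, tableFn_apply hans hj]),
    ← flatten_ofFn_eq_ccat (fun j : Fin (2 ^ ℓ) => boolPair (learnerTable hn f i j z) []), flatten_ofFn_boolPair_nil]

/-- **The learner's tables are the NW tables for the blocks before the challenge block.**
[cite: CarmosinoImpagliazzoKabanetsKolokolova2016, §5 (step 2)] -/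
theorem learnerTables_getD (hn : k * n + k ≤ q) (f : (Fin n → Bool) → Bool) (i : Fin (2 ^ ℓ)) (z : Fin (q * q) → Bool)
    (j : Fin (2 ^ ℓ)) (hji : (j : ℕ) < i) :
    (List.ofFn fun j : Fin (2 ^ ℓ) => learnerTable hn f i j z).getD j [] =
      tableList (learnerDesign q n k ℓ hn) (ampFnFin f k) q i j z := by
  rw [List.getD_eq_getElem _ _ (by simp), List.getElem_ofFn, Fin.eta,
    learnerTable_eq_tableList hn f (fun h => by rw [h] at hji; exact lt_irrefl _ hji)]

end TableValues2

end Literature.Computability.Learning
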